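import Mathlib.Topology.Algebra.OpenSubgroup
import Mathlib.Topology.Algebra.Group.Basic
import Mathlib.Topology.Algebra.ContinuousMonoidHom
import Mathlib.Topology.Algebra.Category.ProfiniteGrp.Completion
import Mathlib.GroupTheory.Commensurable
import Mathlib.GroupTheory.Finiteness
import Mathlib.GroupTheory.FreeGroup.Basic
import Mathlib.GroupTheory.Index
import Mathlib.Algebra.Group.Subgroup.Pointwise
import Mathlib.FieldTheory.KrullTopology
import Mathlib.FieldTheory.IsAlgClosed.AlgebraicClosure
import Mathlib.NumberTheory.Padics.PadicNumbers
import HarnessLib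

/-!
# Tempered anabelian geometry over local fields ([SemiAnbd] §6: Lem. 6.1–6.3, Thm. 6.5, 6.6)

Mochizuki, *Semi-graphs of anabelioids*, Publ. RIMS **42** (2006) 221–322 [SemiAnbd], §6
"Tempered Anabelian Geometry", author's manuscript pp. 69–73: Lemma 6.1 (Profinite Normalizers),
Definition 6.2 (subgroups / homomorphisms of DFG- and DOF-type), Lemma 6.3 (Dense Subgroups),
Theorem 6.5 (Tempered Decomposition Groups), Theorem 6.6 (Tempered and Profinite Outer
Isomorphisms). [cite: MochizukiSemiAnbd2006, §6 pp.69-73]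

## Level of the typing (abc-iut cell, STATEMENTS-FIRST)

The setting of §6 (p. 69) is: `K` a finite extension of `ℚ_p`, `K̄` an algebraic closure, `X_K` a
hyperbolic curve over `K`, `Π^temp_{X_K} = π₁^temp(X_K)` its tempered fundamental group (André), a
tempered topological group sitting in `1 → Δ^temp_X → Π^temp_{X_K} → G_K → 1`, with profinite
completions `Π_{X_K} = (Π^temp_{X_K})^∧`, `Δ_X` and natural injections `Π^temp ↪ Π`, `Δ^temp ↪ Δ`;
decomposition groups `D_x ⊆ Π^temp_{X_K}` of closed points `x` of the compactification `X̄_K`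
(p. 71).  None of: hyperbolic curves over `p`-adic fields, their (tempered or étale) fundamental
groups, decomposition groups, dominant morphisms of curves, is in the tree (abc-iut FOUNDATIONS rows
12–13; the tempered-`π₁` INTERFACE is owned by seat abc-iut-L3-t2, the profinite one by abc-iut-L4-t1
-- TODO-merge: abc-iut-L3-t2, abc-iut-L4-t1).  Following the cell rule "absent deep inputs =
INTERFACE structures whose axioms quote print", this file

* DEFINES, for an arbitrary continuous homomorphism `ι : F → F̂` into a topological group, the
  predicate "`F̂` is the profinite completion of `F`" (`IsProfiniteCompletion`), and Definition 6.2
  (`IsDFGType`, `IsDOFType`, and the versions for homomorphisms) over Mathlib;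
* states Lemma 6.1 (i) and Lemma 6.3 (i) — statements about finitely generated free groups and
  Mathlib's `ProfiniteGrp.ProfiniteCompletion` — as honest NAMED FACTS (`def … : Prop`, unproved;
  [André] Lem. 3.2.1 resp. the structure theory of f.g. subgroups of free groups);
* records the §6 setting as the interface `TemperedCurve p`: the base field `K` is an actual
  finite-dimensional `IntermediateField ℚ_[p] (AlgebraicClosure ℚ_[p])` and
  `G_K = K.fixingSubgroup ≤ G_{ℚ_p} = AlgebraicClosure ℚ_[p] ≃ₐ[ℚ_[p]] AlgebraicClosure ℚ_[p]`
  (Mathlib's `Field.absoluteGaloisGroup ℚ_[p]`, Krull topology); the tempered group, its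
  augmentation to `G_{ℚ_p}` with image `G_K`, its profinite completion, and the decomposition groups
  of the closed points of `X̄_K` are abstract data whose Prop-fields quote p. 69 / p. 71;
* types Lemma 6.1 (ii)(iii), Lemma 6.3 (ii)(iii), Theorem 6.5 (i)–(iv), Theorem 6.6 as
  PREDICATES on such data (one `def … : Prop` per printed sub-item).  These predicates become facts
  about the honest objects once the interfaces are instantiated; nothing is asserted here.

Deliberately NOT here: Theorem 6.4, the category `DLoc`, Definition 6.7 – Remark 6.12.1 (they need
dominant morphisms / localizations of the curves as further interface data: companion file
`TemperedAnabelianMorphisms.lean`); Remark 6.6.1 (p. 73: "the technique used in the proof of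
Theorem 6.6 may also be applied to give another proof of Theorem 6.5, (iii)" — a remark about proofs
with no statement content).  `Ẑ(1)` (p. 71) is rendered as the profinite completion of `ℤ` ("the
profinite completion of `ℤ`, Tate twisted once" — the twist concerns the Galois action and is not
recorded).  No statement is strengthened; nothing here takes a side on [IUTchIII] Cor. 3.12.
-/

noncomputable section

namespace Literature.AnabelianGeometry.SemiGraphs

open scoped Pointwise
open Topology

universe u v

/-! ### Profinite completions of topological groups -/

/-- `ι : F → F̂` exhibits the topological group `F̂` as *the profinite completion* of the topological
group `F` ([SemiAnbd] §6 p. 69: "we shall denote the profinite completion of a group by means of a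
`∧`"): `F̂` is compact, Hausdorff and totally disconnected, `ι` has dense image, and the open normal
subgroups of finite index of `F` are exactly the inverse images of the open normal subgroups of
`F̂`. [cite: MochizukiSemiAnbd2006, §6 p.69] -/
@[mk_iff] structure IsProfiniteCompletion {F : Type u} {Fhat : Type v} [Group F] [TopologicalSpace F]
    [Group Fhat] [TopologicalSpace Fhat] (ι : F →ₜ* Fhat) : Prop where
  compactSpace : CompactSpace Fhat
  t2Space : T2Space Fhat
  totallyDisconnectedSpace : TotallyDisconnectedSpace Fhat
  denseRange : DenseRange ι
  comap_surjective : ∀ U : OpenNormalSubgroup F, U.toSubgroup.FiniteIndex →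
    ∃ V : OpenNormalSubgroup Fhat, U.toSubgroup = V.toSubgroup.comap ι.toMonoidHom
  isOpen_comap : ∀ V : OpenNormalSubgroup Fhat, IsOpen (V.toSubgroup.comap ι.toMonoidHom : Set F)

/-! ### Lemma 6.1 (i) and Lemma 6.3 (i): free groups in their profinite completions -/

section FreeGroups

open CategoryTheory ProfiniteGrp.ProfiniteCompletion

/-- The canonical homomorphism `F → F̂` from a (discrete) group to Mathlib's profinite completion,
as a bare monoid homomorphism. [cite: MochizukiSemiAnbd2006, §6 p.69] -/
abbrev toProfiniteCompletion (F : Type u) [Group F] :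
    F →* (completion (GrpCat.of F) : ProfiniteGrp.{u}) :=
  (eta (GrpCat.of F)).hom

/-- **[SemiAnbd] Lemma 6.1 (i) (Profinite Normalizers)**, p. 69: "Let `F` be a finitely generated
[discrete] free group of rank `> 1`. Then `N_{F̂}(F) = F`" — the image of `F` in its profinite
completion `F̂` is its own normalizer.  (Proof in print: [André], Lemma 3.2.1.)  Named fact,
unproved here. [cite: MochizukiSemiAnbd2006, Lem 6.1(i) p.69] -/
def FreeGroupNormallyTerminalInCompletion : Prop :=
  ∀ (n : ℕ), 1 < n →
    Subgroup.normalizer (MonoidHom.range (toProfiniteCompletion (FreeGroup (Fin n))) : Set _) =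
      MonoidHom.range (toProfiniteCompletion (FreeGroup (Fin n)))

/-- **[SemiAnbd] Lemma 6.3 (i) (Dense Subgroups)**, p. 70: "Let `F` be a finitely generated
[discrete] free group of rank `> 1`. Suppose that `H ⊆ F` is a finitely generated subgroup which is
dense in `F̂`. Then `H = F`."  Named fact, unproved here (print: from the structure theory of f.g.
subgroups of free groups, [SemiAnbd] Cor. 1.6 (ii)). [cite: MochizukiSemiAnbd2006, Lem 6.3(i) p.70] -/
def FreeGroupDenseFGSubgroupEqTop : Prop :=
  ∀ (n : ℕ), 1 < n → ∀ H : Subgroup (FreeGroup (Fin n)), H.FG →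
    Dense ((toProfiniteCompletion (FreeGroup (Fin n))) '' (H : Set (FreeGroup (Fin n)))) → H = ⊤

end FreeGroups

/-! ### Definition 6.2: subgroups and homomorphisms of DFG-type and of DOF-type -/

section DFG

variable {F : Type u} {Fhat : Type v} [Group F] [TopologicalSpace F] [Group Fhat]
  [TopologicalSpace Fhat]

/-- **[SemiAnbd] Definition 6.2 (i)**, pp. 69–70: a [not necessarily closed] subgroup `H ⊆ F` of a
tempered group `F` (with profinite completion `ι : F → F̂`) is *of DFG-type* ["dense, finitely
generated type"] if "it is dense in some open subgroup of the profinite completion `F̂`, and,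
moreover, for any open normal subgroup `J ⊆ F`, the image of `H` in `F/J` is finitely generated".
[cite: MochizukiSemiAnbd2006, Def 6.2(i) pp.69-70] -/
def IsDFGType (ι : F →ₜ* Fhat) (H : Subgroup F) : Prop :=
  (∃ U : Subgroup Fhat, IsOpen (U : Set Fhat) ∧ closure (ι '' (H : Set F)) = (U : Set Fhat)) ∧
    ∀ J : OpenNormalSubgroup F, (H.map (QuotientGroup.mk' J.toSubgroup)).FG

/-- **[SemiAnbd] Definition 6.2 (ii)**, p. 70: `H ⊆ F` is *of DOF-type* ["dense in an open subgroup
of finite index type"] if "it is dense in some open subgroup of `F` of finite index".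
[cite: MochizukiSemiAnbd2006, Def 6.2(ii) p.70] -/
def IsDOFType (H : Subgroup F) : Prop :=
  ∃ U : Subgroup F, IsOpen (U : Set F) ∧ U.FiniteIndex ∧ closure (H : Set F) = (U : Set F)

variable {F₂ : Type v} [Group F₂] [TopologicalSpace F₂] {F₂hat : Type u} [Group F₂hat]
  [TopologicalSpace F₂hat]

/-- **[SemiAnbd] Definition 6.2 (iii)**, p. 70, DFG case: a continuous homomorphism `F₁ → F₂` is
*of DFG-type* if its image is a subgroup of `F₂` of DFG-type (relative to the profinite completion
`ι₂ : F₂ → F̂₂`). [cite: MochizukiSemiAnbd2006, Def 6.2(iii) p.70] -/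
def IsDFGTypeHom (ι₂ : F₂ →ₜ* F₂hat) (φ : F →ₜ* F₂) : Prop := IsDFGType ι₂ φ.toMonoidHom.range

/-- **[SemiAnbd] Definition 6.2 (iii)**, p. 70, DOF case: a continuous homomorphism `F₁ → F₂` is
*of DOF-type* if its image is a subgroup of `F₂` of DOF-type.
[cite: MochizukiSemiAnbd2006, Def 6.2(iii) p.70] -/
def IsDOFTypeHom (φ : F →ₜ* F₂) : Prop := IsDOFType φ.toMonoidHom.range

end DFG

/-! ### The §6 setting as an interface: a hyperbolic curve over a finite extension of `ℚ_p` -/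

section Setting

variable (p : ℕ) [Fact p.Prime]

/-- `G_{ℚ_p} = Gal(K̄/ℚ_p)` for the fixed algebraic closure `K̄ = AlgebraicClosure ℚ_[p]`, with its
Krull topology; definitionally Mathlib's `Field.absoluteGaloisGroup ℚ_[p]` ([SemiAnbd] §6 p. 69:
"`G_K := Gal(K̄/K)`"). [cite: MochizukiSemiAnbd2006, §6 p.69] -/
abbrev GQp : Type := AlgebraicClosure ℚ_[p] ≃ₐ[ℚ_[p]] AlgebraicClosure ℚ_[p]

/-- `Ẑ`, the profinite completion of `ℤ` (p. 71: "`Ẑ(1)` [i.e., the profinite completion of `ℤ`,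
Tate twisted once]"), as a profinite group. [cite: MochizukiSemiAnbd2006, §6 p.71] -/
abbrev ZHat : ProfiniteGrp.{0} :=
  ProfiniteGrp.ProfiniteCompletion.completion (GrpCat.of (Multiplicative ℤ))

/-- **The §6 interface** ([SemiAnbd] pp. 69, 71).  A `TemperedCurve p` is the datum attached to a
hyperbolic curve `X_K` over a finite extension `K` of `ℚ_p` inside the fixed algebraic closure `K̄`:
the tempered fundamental group `Π^temp_{X_K}` ("a tempered topological group … fits into a natural
exact sequence `1 → π₁^temp(X_K̄) → π₁^temp(X_K) → G_K → 1`", p. 69), recorded through its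
augmentation `Π^temp_{X_K} → G_{ℚ_p}` with image `G_K = Gal(K̄/K)`; the profinite completion
`Π_{X_K} = (Π^temp_{X_K})^∧` with "natural injection `Π^temp_{X_K} ↪ Π_{X_K}`" (p. 69, from
residual finiteness of free groups) and the profinite augmentation `Π_{X_K} → G_K`; the closed points
`x` of the compactification `X̄_K`, the cusps among them, and for each `x` one representative `D_x`
of the conjugacy class of decomposition groups ("`x` determines, up to conjugation by an element of
`Π^temp_{X_K}`, a decomposition group `D_x ⊆ Π^temp_{X_K}`", p. 71), with "`D_x` always surjects
onto an open subgroup of `G_K`" and "`I_x := D_x ∩ Δ^temp_X` is isomorphic to `Ẑ(1)` (respectively,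
`{1}`) if `x` is (respectively, is not) a cusp" (p. 71).  INTERFACE BOUNDARY: the curve `X_K` itself
(a scheme), André's construction of `π₁^temp`, and the construction of `D_x` from `x` are not in the
tree -- TODO-merge: abc-iut-L3-t2 (tempered `π₁`, [SemiAnbd] §3), abc-iut-L4-t1 (profinite `π₁`,
decomposition groups). [cite: MochizukiSemiAnbd2006, §6 pp.69-71] -/
structure TemperedCurve : Type 1 where
  /-- the base field `K`, a finite extension of `ℚ_p` inside `K̄` -/
  K : IntermediateField ℚ_[p] (AlgebraicClosure ℚ_[p])
  finiteDimensional_K : FiniteDimensional ℚ_[p] K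
  /-- the tempered fundamental group `Π^temp_{X_K}` -/
  PiTemp : Type
  [group : Group PiTemp]
  [topologicalSpace : TopologicalSpace PiTemp]
  [topologicalGroup : IsTopologicalGroup PiTemp]
  /-- the augmentation `Π^temp_{X_K} → G_{ℚ_p}` (with image `G_K`) -/
  aug : PiTemp →ₜ* GQp p
  range_aug : aug.toMonoidHom.range = K.fixingSubgroup
  /-- the profinite completion `Π_{X_K}` -/
  PiHat : Type
  [groupHat : Group PiHat]
  [topologicalSpaceHat : TopologicalSpace PiHat]
  [topologicalGroupHat : IsTopologicalGroup PiHat]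
  /-- `Π^temp_{X_K} → Π_{X_K}` -/
  toHat : PiTemp →ₜ* PiHat
  isProfiniteCompletion_toHat : IsProfiniteCompletion toHat
  /-- "natural injection" (p. 69) -/
  toHat_injective : Function.Injective toHat
  /-- the profinite augmentation `Π_{X_K} → G_K ≤ G_{ℚ_p}`, extending `aug` -/
  augHat : PiHat →ₜ* GQp p
  augHat_comp : ∀ g : PiTemp, augHat (toHat g) = aug g
  /-- closed points of the compactification `X̄_K` -/
  Pt : Type
  /-- the cusps among the closed points of `X̄_K` -/
  IsCusp : Pt → Prop
  /-- a representative decomposition group `D_x ⊆ Π^temp_{X_K}` -/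
  decomp : Pt → Subgroup PiTemp
  isClosed_decomp : ∀ x, IsClosed (decomp x : Set PiTemp)
  /-- "`D_x` always surjects onto an open subgroup of `G_K`" (p. 71) -/
  isOpen_aug_decomp : ∀ x, IsOpen (aug '' (decomp x : Set PiTemp))
  /-- "`I_x = D_x ∩ Δ^temp_X` is … `{1}` if `x` is not a cusp" (p. 71) -/
  inertia_eq_bot : ∀ x, ¬ IsCusp x → decomp x ⊓ aug.toMonoidHom.ker = ⊥
  /-- "`I_x` is isomorphic to `Ẑ(1)` if `x` is a cusp" (p. 71) -/
  inertia_equiv_zHat : ∀ x, IsCusp x → Nonempty (↥(decomp x ⊓ aug.toMonoidHom.ker) ≃ₜ* ZHat)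

attribute [instance] TemperedCurve.group TemperedCurve.topologicalSpace
  TemperedCurve.topologicalGroup TemperedCurve.groupHat TemperedCurve.topologicalSpaceHat
  TemperedCurve.topologicalGroupHat

namespace TemperedCurve

variable {p}

/-- `G_K = Gal(K̄/K) ≤ G_{ℚ_p}` (p. 69). [cite: MochizukiSemiAnbd2006, §6 p.69] -/
def GK (X : TemperedCurve p) : Subgroup (GQp p) := X.K.fixingSubgroup

/-- `Δ^temp_X = π₁^temp(X_K̄)`, the geometric tempered fundamental group = the kernel of the
augmentation (exact sequence of p. 69). [cite: MochizukiSemiAnbd2006, §6 p.69] -/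
def DeltaTemp (X : TemperedCurve p) : Subgroup X.PiTemp := X.aug.toMonoidHom.ker

/-- `Δ_X`, the profinite completion of `Δ^temp_X`, realised as the closure of the image of
`Δ^temp_X` in `Π_{X_K}` (p. 69; cf. p. 73 "the `∧` denotes profinite completion, or, equivalently,
closure in `Π_{X_K}`"). [cite: MochizukiSemiAnbd2006, §6 p.69] -/
def DeltaHat (X : TemperedCurve p) : Subgroup X.PiHat := (X.DeltaTemp.map X.toHat.toMonoidHom).topologicalClosure

/-- `I_x := D_x ∩ Δ^temp_X` (p. 71). [cite: MochizukiSemiAnbd2006, §6 p.71] -/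
def inertia (X : TemperedCurve p) (x : X.Pt) : Subgroup X.PiTemp := X.decomp x ⊓ X.DeltaTemp

/-- A *decomposition group* of `Π^temp_{X_K}`: a conjugate of some `D_x` ("a closed subgroup of
`Π^temp_{X_K}` which arises in this way", p. 71). [cite: MochizukiSemiAnbd2006, §6 p.71] -/
def IsDecompositionGroup (X : TemperedCurve p) (D : Subgroup X.PiTemp) : Prop :=
  ∃ x : X.Pt, ∃ γ : ConjAct X.PiTemp, D = γ • X.decomp x

/-- A *cuspidal* decomposition group: a conjugate of `D_x` for a cusp `x` (p. 71).
[cite: MochizukiSemiAnbd2006, §6 p.71] -/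
def IsCuspidalDecompositionGroup (X : TemperedCurve p) (D : Subgroup X.PiTemp) : Prop :=
  ∃ x : X.Pt, X.IsCusp x ∧ ∃ γ : ConjAct X.PiTemp, D = γ • X.decomp x

/-- A *cuspidal geometric decomposition group*: a closed subgroup equal to (a conjugate of) `I_x`
for some cusp `x` (p. 71). [cite: MochizukiSemiAnbd2006, §6 p.71] -/
def IsCuspidalGeometricDecompositionGroup (X : TemperedCurve p) (I : Subgroup X.PiTemp) : Prop :=
  ∃ x : X.Pt, X.IsCusp x ∧ ∃ γ : ConjAct X.PiTemp, I = γ • X.inertia x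

/-! #### Lemma 6.1 (ii), (iii); Lemma 6.3 (ii), (iii) -/

/-- **[SemiAnbd] Lemma 6.1 (ii)**, p. 69: "`N_{Δ_X}(Δ^temp_X) = Δ^temp_X`" (print: [André],
Cor. 6.2.2), with `Δ^temp_X ↪ Δ_X ⊆ Π_{X_K}`. [cite: MochizukiSemiAnbd2006, Lem 6.1(ii) p.69] -/
def DeltaTempNormallyTerminal (X : TemperedCurve p) : Prop :=
  Subgroup.normalizer
      (((X.DeltaTemp.map X.toHat.toMonoidHom).subgroupOf X.DeltaHat : Subgroup X.DeltaHat) :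
        Set X.DeltaHat) =
    (X.DeltaTemp.map X.toHat.toMonoidHom).subgroupOf X.DeltaHat

/-- **[SemiAnbd] Lemma 6.1 (iii)**, p. 69: "`N_{Π_{X_K}}(Π^temp_{X_K}) = Π^temp_{X_K}`".
[cite: MochizukiSemiAnbd2006, Lem 6.1(iii) p.69] -/
def PiTempNormallyTerminal (X : TemperedCurve p) : Prop :=
  Subgroup.normalizer (X.toHat.toMonoidHom.range : Set X.PiHat) = X.toHat.toMonoidHom.range

/-- **[SemiAnbd] Lemma 6.3 (ii)**, p. 70, case `F = Π^temp_{X_K}`: "a subgroup `H ⊆ F` is of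
DFG-type if and only if it is of DOF-type". [cite: MochizukiSemiAnbd2006, Lem 6.3(ii) p.70] -/
def PiTempDFGIffDOF (X : TemperedCurve p) : Prop := ∀ H : Subgroup X.PiTemp, IsDFGType X.toHat H ↔ IsDOFType H

/-- The restriction `Δ^temp_X → Δ_X` of `Π^temp_{X_K} → Π_{X_K}` (p. 69).
[cite: MochizukiSemiAnbd2006, §6 p.69] -/
def deltaToHat (X : TemperedCurve p) : X.DeltaTemp →ₜ* X.DeltaHat where
  toFun g := ⟨X.toHat g.1,
    Subgroup.le_topologicalClosure _ (Subgroup.mem_map_of_mem X.toHat.toMonoidHom g.2)⟩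
  map_one' := by ext; simp
  map_mul' a b := by ext; simp
  continuous_toFun := by
    refine Continuous.subtype_mk ?_ _
    exact X.toHat.continuous.comp continuous_subtype_val

/-- **[SemiAnbd] Lemma 6.3 (ii)**, p. 70, case `F = Δ^temp_X`: "a subgroup `H ⊆ F` is of DFG-type
if and only if it is of DOF-type". [cite: MochizukiSemiAnbd2006, Lem 6.3(ii) p.70] -/
def DeltaTempDFGIffDOF (X : TemperedCurve p) : Prop :=
  ∀ H : Subgroup X.DeltaTemp, IsDFGType X.deltaToHat H ↔ IsDOFType H

/-- **[SemiAnbd] Lemma 6.3 (iii)**, p. 70, case `F = Π^temp_{X_K}`: "Suppose that `F₁, F₂ ⊆ F` are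
subgroups of DOF-type which are dense in `F̂`. Then, for any `f ∈ F̂` such that
`f · F₁ · f⁻¹ = F₂`, it follows that `f ∈ F`." [cite: MochizukiSemiAnbd2006, Lem 6.3(iii) p.70] -/
def PiTempDenseDOFConjugator (X : TemperedCurve p) : Prop :=
  ∀ F₁ F₂ : Subgroup X.PiTemp, IsDOFType F₁ → IsDOFType F₂ →
    Dense (X.toHat '' (F₁ : Set X.PiTemp)) → Dense (X.toHat '' (F₂ : Set X.PiTemp)) →
    ∀ f : ConjAct X.PiHat, f • F₁.map X.toHat.toMonoidHom = F₂.map X.toHat.toMonoidHom →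
      ConjAct.ofConjAct f ∈ X.toHat.toMonoidHom.range

/-- **[SemiAnbd] Lemma 6.3 (iii)**, p. 70, case `F = Δ^temp_X`.
[cite: MochizukiSemiAnbd2006, Lem 6.3(iii) p.70] -/
def DeltaTempDenseDOFConjugator (X : TemperedCurve p) : Prop :=
  ∀ F₁ F₂ : Subgroup X.DeltaTemp, IsDOFType F₁ → IsDOFType F₂ →
    Dense (X.deltaToHat '' (F₁ : Set X.DeltaTemp)) → Dense (X.deltaToHat '' (F₂ : Set X.DeltaTemp)) →
    ∀ f : ConjAct X.DeltaHat, f • F₁.map X.deltaToHat.toMonoidHom = F₂.map X.deltaToHat.toMonoidHom →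
      ConjAct.ofConjAct f ∈ X.deltaToHat.toMonoidHom.range

/-! #### Theorem 6.5 (Tempered Decomposition Groups), pp. 71–72 -/

/-- **[SemiAnbd] Theorem 6.5 (i) (Determination of the Point)**, p. 71, first sentence: "The
closed point `x` is completely determined by the conjugacy class of the closed subgroup
`D_x ⊆ Π^temp_{X_K}`." [cite: MochizukiSemiAnbd2006, Thm 6.5(i) p.71] -/
def DecompDeterminesPoint (X : TemperedCurve p) : Prop :=
  ∀ x x' : X.Pt, (∃ γ : ConjAct X.PiTemp, X.decomp x' = γ • X.decomp x) → x' = x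

/-- **[SemiAnbd] Theorem 6.5 (i)**, p. 71, second sentence: "If `x` is a cusp, then `x` is
completely determined by the conjugacy class of the closed subgroup `I_x ⊆ Π^temp_{X_K}`."
[cite: MochizukiSemiAnbd2006, Thm 6.5(i) p.71] -/
def InertiaDeterminesCusp (X : TemperedCurve p) : Prop :=
  ∀ x x' : X.Pt, X.IsCusp x → (∃ γ : ConjAct X.PiTemp, X.inertia x' = γ • X.inertia x) → x' = x

/-- **[SemiAnbd] Theorem 6.5 (ii) (Commensurable Terminality)**, p. 71, first sentence: "The
subgroup `D_x` is commensurably terminal in `Π^temp_{X_K}`."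
[cite: MochizukiSemiAnbd2006, Thm 6.5(ii) p.71] -/
def DecompCommensurablyTerminal (X : TemperedCurve p) : Prop :=
  ∀ x : X.Pt, Subgroup.Commensurable.commensurator (X.decomp x) = X.decomp x

/-- **[SemiAnbd] Theorem 6.5 (ii)**, p. 71, second sentence: "If `x` is a cusp, then
`D_x = C_{Π^temp_{X_K}}(H)` for any open subgroup `H ⊆ I_x`."
[cite: MochizukiSemiAnbd2006, Thm 6.5(ii) p.71] -/
def DecompEqCommensuratorOfOpenInertia (X : TemperedCurve p) : Prop :=
  ∀ x : X.Pt, X.IsCusp x → ∀ H : Subgroup X.PiTemp, H ≤ X.inertia x →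
    IsOpen ((H.subgroupOf (X.inertia x) : Subgroup (X.inertia x)) : Set (X.inertia x)) →
      Subgroup.Commensurable.commensurator H = X.decomp x

/-- **[SemiAnbd] Theorem 6.5 (iii) (Absoluteness of Cuspidal Decomposition Groups)**, p. 72:
"Every isomorphism of tempered groups `α : Π^temp_{X_K} ≅ Π^temp_{Y_L}` preserves cuspidal
decomposition groups and cuspidal geometric decomposition groups."
[cite: MochizukiSemiAnbd2006, Thm 6.5(iii) p.72] -/
def IsoPreservesCuspidalDecomp (X Y : TemperedCurve p) : Prop :=
  ∀ α : X.PiTemp ≃ₜ* Y.PiTemp, ∀ D : Subgroup X.PiTemp,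
    (X.IsCuspidalDecompositionGroup D →
      Y.IsCuspidalDecompositionGroup (D.map α.toMulEquiv.toMonoidHom)) ∧
    (X.IsCuspidalGeometricDecompositionGroup D →
      Y.IsCuspidalGeometricDecompositionGroup (D.map α.toMulEquiv.toMonoidHom))

/-- **[SemiAnbd] Theorem 6.5 (iv) (Cuspidal and Noncuspidal Decomposition Groups)**, p. 72: "No
noncuspidal decomposition group of `Π^temp_{X_K}` is contained in a cuspidal decomposition group of
`Π^temp_{X_K}`." [cite: MochizukiSemiAnbd2006, Thm 6.5(iv) p.72] -/
def NoncuspidalNotLeCuspidal (X : TemperedCurve p) : Prop :=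
  ∀ x x' : X.Pt, ¬ X.IsCusp x → X.IsCusp x' →
    ∀ γ γ' : ConjAct X.PiTemp, ¬ (γ • X.decomp x ≤ γ' • X.decomp x')

/-! #### Theorem 6.6 (Tempered and Profinite Outer Isomorphisms), p. 72 -/

/-- **[SemiAnbd] Theorem 6.6**, p. 72: "Every outer isomorphism `Π_{X_K} ≅ Π_{Y_L}` of profinite
groups arises from a unique outer isomorphism `Π^temp_{X_K} ≅ Π^temp_{Y_L}` of tempered groups":
for every isomorphism `α̂` of the profinite completions there is an isomorphism `β` of the tempered
groups with `α̂ ∘ ι_X` and `ι_Y ∘ β` differing by an inner automorphism of `Π_{Y_L}` (existence), and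
any two such `β` differ by an inner automorphism of `Π^temp_{Y_L}` (uniqueness).
[cite: MochizukiSemiAnbd2006, Thm 6.6 p.72] -/
def ProfiniteOuterIsoLifts (X Y : TemperedCurve p) : Prop :=
  ∀ αhat : X.PiHat ≃ₜ* Y.PiHat,
    (∃ β : X.PiTemp ≃ₜ* Y.PiTemp, ∃ c : Y.PiHat, ∀ g : X.PiTemp,
        αhat (X.toHat g) = c * Y.toHat (β g) * c⁻¹) ∧
    (∀ β β' : X.PiTemp ≃ₜ* Y.PiTemp,
      (∃ c : Y.PiHat, ∀ g : X.PiTemp, αhat (X.toHat g) = c * Y.toHat (β g) * c⁻¹) →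
      (∃ c' : Y.PiHat, ∀ g : X.PiTemp, αhat (X.toHat g) = c' * Y.toHat (β' g) * c'⁻¹) →
        ∃ y : Y.PiTemp, ∀ g : X.PiTemp, β' g = y * β g * y⁻¹)

end TemperedCurve

end Setting

end Literature.AnabelianGeometry.SemiGraphs

end
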